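import Literature.AlgebraicGeometry.ComplexMultiplication.TateModuleOfCMRegularRepresentation
import Literature.NumberTheory.Automorphic.Liu2021.AppendixC.Thm415Pinned
import Mathlib.RingTheory.TensorProduct.IsBaseChangeHom
import Mathlib.NumberTheory.NumberField.InfinitePlace.Embeddings
import Mathlib.Algebra.Algebra.Hom.Rat
import HarnessLib

/-!
# The `M_μ`-eigenline `ℚ_ℓ^{ac}·α` of `ℚ_ℓ^{ac} ⊗ H¹_ét(A_μ)` is a LINE, is `Γ_E`-stable, and is cut out by a
# polynomial in the `M_μ`-action ([Liu 2021, Thm 4.18 proof l. 2250–2263]; [Serre–Tate 1968, §4 Thm 5 (i)])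

Topic `NumberTheory/Automorphic/Liu2021/AppendixC`; namespace `Literature.NumberTheory.Automorphic.Liu2021.AppendixC`.
THEOREMS ONLY about the objects of `Thm415Pinned.lean` (B-typ04, p593306): the eigenline
`cmEigenline ℓ B M i ι ⊆ ℚ_ℓ^{ac} ⊗_{ℚ_ℓ} H¹_ét(B ⊗_E Ē, ℚ_ℓ)` («the line `ℚ_ℓ^{ac}·α`») and the Galois operators
`galoisH1Bar ℓ B σ`.  No definition, no named fact, no `sorry`; net Literature debt 0.  Cell `hodgecm-mathlib` (D-0151),
line `a3-liu418` v3, stub F `stub_faltingsIsotypic` (KEY `a3-faltings-isotypic`): conjunct (i) of `FaltingsIsotypic` and the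
inputs of the level-wise Faltings step.  HC_CM is proved only modulo the 7 printed citations until rung 0 closes; this file
asserts nothing of [Liu2021].

## The printed text (Y. Liu, *Fourier–Jacobi cycles and arithmetic relative trace formula*, Camb. J. Math. 9 (2021) =
## arXiv:2102.11518, `FJcycle.tex` l. 2250 and l. 2258–2263; print pp. 52–53)

«It is clear that the maximal subspace of the complex vector space `H¹_{B,τ'}(A_μ, ℂ)` over which `M_μ` acts via the
inclusion `M_μ ↪ ℂ` has dimension `1`. We choose a basis `α` of this subspace. […] the action of `Gal(ℂ/τ'(E))` on the line
`ℚ_ℓ^{ac}·α` spanned by `α` is given by the automorphic character `ι_ℓ ∘ μ^{alg} ∘ (τ')⁻¹`».  «It is clear» = [Def 4.5 (2)]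
(`[M_μ : ℚ] = 2 dim A_μ`) + [Serre–Tate 1968, §4 Thm 5 (i)] («The `F_l`-module `V_l` is free of rank 1»); proved here `ℓ`-adically.

## Contents (all PROVED; axioms `propext`, `Classical.choice`, `Quot.sound`)

For a field `E`, a prime `ℓ` invertible in `E` (`hℓ`), an abelian variety `B / E`, a number field `M ⊆ ℂ` acting by
`i : M →+* End⁰(B)` with `[M : ℚ] = 2 dim B` (`hdim`) and `ι : ℂ ≃+* ℚ_ℓ^{ac}`:
* §0 `toDualBaseChange_dualMap_baseChange` — naturality in `V` of Mathlib's `δ_V : K ⊗_k V^∨ ≃ (K ⊗_k V)^∨`.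
* §1 **`finrank_cmEigenline_eq_one`** — `dim_{ℚ_ℓ^{ac}} (ℚ_ℓ^{ac}·α) = 1` (conjunct (i) of `FaltingsIsotypic`), with
  `exists_mem_cmEigenline_ne_zero`.  Proof: the eigenbasis `(b_τ)_{τ : M → ℚ_ℓ^{ac}}` of `ℚ_ℓ^{ac} ⊗ V_ℓ(B)`
  (tree `ComplexMultiplication.exists_basis_baseChange_rationalTateAction_eq_smul_ringHom` = Serre–Tate Thm 5 (i) in
  diagonal form) has a dual basis of eigen-functionals; under `δ` the eigenline is the line of `b*_{ι|M}`
  (`apply_eigenbasis_eq_zero_of_ne`, `dualBasis_comp_baseChange_eq_smul`, `mem_cmEigenline_iff_toDualBaseChange`).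
* §2 `mem_cmEigenline_of_commute`, `exists_apply_eq_smul_of_commute` — an operator commuting with the `M`-action
  preserves the line and acts on it by a scalar; `galoisH1Bar_comp_dualMap_baseChange` (Galois commutes with `M`,
  tree `rationalTateAction_comm_rationalTateRep` dualised), hence **`galoisH1Bar_mem_cmEigenline`** (the line is
  `Γ_E`-stable) and **`exists_galoisH1Bar_eq_smul`** (`Γ_E` acts on it through a character `σ ↦ c(σ)`).
* §3 **`exists_cmEigenline_projector`** — a finite family `(c_j, m_j) ∈ ℚ_ℓ^{ac} × M` with `Σ c_j ι(m_j) = 1` whose operator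
  `P = Σ c_j (1 ⊗ ᵗV_ℓ(i m_j))` maps `ℚ_ℓ^{ac} ⊗ H¹_ét(B)` into the line, fixes the line pointwise, and commutes with every
  operator commuting with `M` — the image of the `τ`-idempotent of `ℚ_ℓ^{ac} ⊗_ℚ M ≅ ∏_τ ℚ_ℓ^{ac}` (eigenbasis of
  `ℚ_ℓ^{ac} ⊗_ℚ M`, tree `exists_basis_tensor_mul_eq_smul_ringHom`, Dedekind independence; [Shimura1998 §5.1 Lemma 1]).
  This is the tool that cuts the `ι|_{M}`-component out of `ℚ_ℓ^{ac} ⊗_ℚ Hom(A_K, A_μ)_ℚ` and extends `Γ_E`-maps from the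
  line in the Faltings step (l. 2258–2262).

Junk analysis: `hℓ`, `hdim` are Serre–Tate's hypotheses (any ground field `E`); §2's stability and §3 need neither.
Galois group `Γ_E = Gal(Ē/E)` as in `EtaleH1Tower.lean` / `Thm415Pinned.lean` (A-plan2 decision (2)).

References: [Liu2021] Thm 4.18 proof, `FJcycle.tex` l. 2250, 2258–2263, Def. 4.5 (2) l. 1946–1952; [SerreTate1968] J.-P. Serre,
J. Tate, *Good reduction of abelian varieties*, Ann. of Math. 88 (1968), §4 Thm. 5 (i), Cor. 2; [Shimura1998] G. Shimura, *Abelian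
Varieties with Complex Multiplication and Modular Functions* (1998), §5.1 Lemma 1, Prop. 1.
-/

noncomputable section

open scoped TensorProduct

namespace Literature.NumberTheory.Automorphic.Liu2021.AppendixC

open Literature.AlgebraicGeometry.Motives (AbelianVariety)
open Literature.AlgebraicGeometry.Motives.AbelianVariety (rationalTateAction rationalTateAction_comm_rationalTateRep
  rationalTateAction_algebraMap module_finite_tateModule_of_cast_ne_zero)

/-! ## §0 Base change of duals commutes with transposes -/

section DualBaseChange

variable {k : Type*} [Field k] (K : Type*) [Field K] [Algebra k K]
  {V V' : Type*} [AddCommGroup V] [Module k V] [AddCommGroup V'] [Module k V']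
  [FiniteDimensional k V] [FiniteDimensional k V']

/-- Naturality of the identification `δ_V : K ⊗_k V^∨ ≃ (K ⊗_k V)^∨` (Mathlib `IsBaseChange.toDualBaseChange` for
`v ↦ 1 ⊗ v`) in the finite-dimensional `k`-space `V`: for `g : V → V'` and `ξ ∈ K ⊗ V'^∨`,
`δ_V ((1 ⊗ g^∨) ξ) = (δ_{V'} ξ) ∘ (1 ⊗ g)`. [folklore] -/
private theorem toDualBaseChange_dualMap_baseChange (g : V →ₗ[k] V') (ξ : K ⊗[k] Module.Dual k V') :
    (TensorProduct.isBaseChange k V K).toDualBaseChange ((g.dualMap.baseChange K) ξ) =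
      ((TensorProduct.isBaseChange k V' K).toDualBaseChange ξ) ∘ₗ (g.baseChange K) := by
  induction ξ using TensorProduct.induction_on with
  | zero => simp only [map_zero, LinearMap.zero_comp]
  | add x y hx hy => simp only [map_add, hx, hy, LinearMap.add_comp]
  | tmul c φ =>
    rw [LinearMap.baseChange_tmul]
    refine TensorProduct.AlgebraTensorModule.ext fun d v => ?_
    have h1 : (d ⊗ₜ[k] v : K ⊗[k] V) = d • ((TensorProduct.mk k K V) 1 v) := by
      rw [TensorProduct.mk_apply, TensorProduct.smul_tmul', smul_eq_mul, mul_one]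
    have h2 : (d ⊗ₜ[k] g v : K ⊗[k] V') = d • ((TensorProduct.mk k K V') 1 (g v)) := by
      rw [TensorProduct.mk_apply, TensorProduct.smul_tmul', smul_eq_mul, mul_one]
    rw [LinearMap.comp_apply, LinearMap.baseChange_tmul, h1, h2, map_smul, map_smul,
      IsBaseChange.toDualBaseChange_tmul, IsBaseChange.toDualBaseChange_tmul, LinearMap.dualMap_apply]

end DualBaseChange

/-! ## §1 The eigenline is a line -/

section CMLine

variable {E : Type} [Field E] (ℓ : ℕ) [Fact ℓ.Prime] (B : AbelianVariety E) (M : Subfield ℂ)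
  (i : M →+* B.endAlgebra) (ι : ℂ ≃+* AlgebraicClosure ℚ_[ℓ])

/-- Under `δ : ℚ_ℓ^{ac} ⊗ V_ℓ(B)^∨ ≃ (ℚ_ℓ^{ac} ⊗ V_ℓ(B))^∨` the eigenline condition reads `φ ∘ (1 ⊗ V_ℓ(i m)) = ι(m) φ`
for all `m ∈ M`. [cite: Liu2021, Thm 4.18 proof (FJcycle.tex l. 2250)] -/
theorem mem_cmEigenline_iff_toDualBaseChange (hℓ : (ℓ : E) ≠ 0)
    (x : AlgebraicClosure ℚ_[ℓ] ⊗[ℚ_[ℓ]] Module.Dual ℚ_[ℓ] (B.rationalTateModule ℓ)) :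
    haveI := module_finite_tateModule_of_cast_ne_zero B ℓ hℓ
    haveI : Module.Finite ℚ_[ℓ] (B.rationalTateModule ℓ) :=
      inferInstanceAs (Module.Finite ℚ_[ℓ] (ℚ_[ℓ] ⊗[ℤ_[ℓ]] B.tateModule ℓ))
    x ∈ cmEigenline ℓ B M i ι ↔ ∀ m : M,
      (TensorProduct.isBaseChange ℚ_[ℓ] (B.rationalTateModule ℓ) (AlgebraicClosure ℚ_[ℓ])).toDualBaseChange x ∘ₗ
          (rationalTateAction B ℓ (i m)).baseChange (AlgebraicClosure ℚ_[ℓ]) =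
        (ι.toRingHom.comp M.subtype) m •
          (TensorProduct.isBaseChange ℚ_[ℓ] (B.rationalTateModule ℓ) (AlgebraicClosure ℚ_[ℓ])).toDualBaseChange x := by
  haveI := module_finite_tateModule_of_cast_ne_zero B ℓ hℓ
  haveI : Module.Finite ℚ_[ℓ] (B.rationalTateModule ℓ) :=
    inferInstanceAs (Module.Finite ℚ_[ℓ] (ℚ_[ℓ] ⊗[ℤ_[ℓ]] B.tateModule ℓ))
  refine forall_congr' fun m => ?_
  rw [← (TensorProduct.isBaseChange ℚ_[ℓ] (B.rationalTateModule ℓ) (AlgebraicClosure ℚ_[ℓ])).toDualBaseChange.injective.eq_iff,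
    toDualBaseChange_dualMap_baseChange, map_smul]
  rfl

/-! ### The eigenbasis of `ℚ_ℓ^{ac} ⊗ V_ℓ(B)` (Serre–Tate §4 Thm 5 (i), tree `exists_basis_baseChange_rationalTateAction_eq_smul_ringHom`)
and its dual basis -/

variable {ℓ B M i}

/-- A functional on `ℚ_ℓ^{ac} ⊗ V_ℓ(B)` on which `M` acts (by precomposition) through the character `τ₀` vanishes on the
eigenvectors `b_τ`, `τ ≠ τ₀`, of an `M`-eigenbasis. [cite: Shimura1998, §5.1 Lemma 1] -/
theorem apply_eigenbasis_eq_zero_of_ne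
    {b : Module.Basis (M →+* AlgebraicClosure ℚ_[ℓ]) (AlgebraicClosure ℚ_[ℓ])
      (AlgebraicClosure ℚ_[ℓ] ⊗[ℚ_[ℓ]] B.rationalTateModule ℓ)}
    (hb : ∀ (a : M) (τ : M →+* AlgebraicClosure ℚ_[ℓ]),
      (rationalTateAction B ℓ (i a)).baseChange (AlgebraicClosure ℚ_[ℓ]) (b τ) = τ a • b τ)
    {τ₀ : M →+* AlgebraicClosure ℚ_[ℓ]}
    {φ : Module.Dual (AlgebraicClosure ℚ_[ℓ]) (AlgebraicClosure ℚ_[ℓ] ⊗[ℚ_[ℓ]] B.rationalTateModule ℓ)}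
    (hφ : ∀ a : M, φ ∘ₗ (rationalTateAction B ℓ (i a)).baseChange (AlgebraicClosure ℚ_[ℓ]) = τ₀ a • φ)
    {τ : M →+* AlgebraicClosure ℚ_[ℓ]} (hτ : τ ≠ τ₀) : φ (b τ) = 0 := by
  obtain ⟨a, ha⟩ : ∃ a : M, τ a ≠ τ₀ a := by
    by_contra h
    exact hτ (RingHom.ext fun a => not_not.mp (not_exists.mp h a))
  have key := LinearMap.congr_fun (hφ a) (b τ)
  rw [LinearMap.comp_apply, hb, map_smul, LinearMap.smul_apply, smul_eq_mul, smul_eq_mul] at key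
  have : (τ a - τ₀ a) * φ (b τ) = 0 := by rw [sub_mul, key, sub_self]
  exact (mul_eq_zero.mp this).resolve_left (sub_ne_zero.mpr ha)

/-- The dual basis vector `b*_{τ₀}` of an `M`-eigenbasis is an eigen-functional for `τ₀` (precomposition action).
[cite: Shimura1998, §5.1 Lemma 1] -/
theorem dualBasis_comp_baseChange_eq_smul [DecidableEq (M →+* AlgebraicClosure ℚ_[ℓ])]
    [Fintype (M →+* AlgebraicClosure ℚ_[ℓ])]
    {b : Module.Basis (M →+* AlgebraicClosure ℚ_[ℓ]) (AlgebraicClosure ℚ_[ℓ])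
      (AlgebraicClosure ℚ_[ℓ] ⊗[ℚ_[ℓ]] B.rationalTateModule ℓ)}
    (hb : ∀ (a : M) (τ : M →+* AlgebraicClosure ℚ_[ℓ]),
      (rationalTateAction B ℓ (i a)).baseChange (AlgebraicClosure ℚ_[ℓ]) (b τ) = τ a • b τ)
    (τ₀ : M →+* AlgebraicClosure ℚ_[ℓ]) (a : M) :
    b.dualBasis τ₀ ∘ₗ (rationalTateAction B ℓ (i a)).baseChange (AlgebraicClosure ℚ_[ℓ]) = τ₀ a • b.dualBasis τ₀ := by
  refine b.ext fun τ => ?_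
  rw [LinearMap.comp_apply, hb, map_smul, LinearMap.smul_apply, Module.Basis.dualBasis_apply_self]
  by_cases h : τ = τ₀
  · subst h; simp
  · simp [h]

variable (ℓ B M i)

/-- **Conjunct (i) of the Faltings step: the `M_μ`-eigenline `ℚ_ℓ^{ac}·α` of `ℚ_ℓ^{ac} ⊗_{ℚ_ℓ} H¹_ét(A_μ)` is a LINE**
(«the maximal subspace … over which `M_μ` acts via the inclusion `M_μ ↪ ℂ` has dimension `1`», [Liu2021] l. 2250, read
`ℓ`-adically through `ι_ℓ`).  For an abelian variety `B` over a field `E` in which `ℓ` is invertible, a number field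
`M ⊆ ℂ` with `[M : ℚ] = 2 dim B` acting by `i : M → End⁰(B)`, and `ι : ℂ ≃ ℚ_ℓ^{ac}`:
`dim_{ℚ_ℓ^{ac}} cmEigenline ℓ B M i ι = 1`.  Proof: `V_ℓ(B)` is free of rank one over `M ⊗ ℚ_ℓ` [Serre–Tate §4 Thm 5 (i)],
so `ℚ_ℓ^{ac} ⊗ V_ℓ(B)` has an eigenbasis `(b_τ)_{τ : M → ℚ_ℓ^{ac}}` (tree
`exists_basis_baseChange_rationalTateAction_eq_smul_ringHom`); under `ℚ_ℓ^{ac} ⊗ V_ℓ^∨ ≃ (ℚ_ℓ^{ac} ⊗ V_ℓ)^∨` the eigenline is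
the line spanned by the dual basis vector `b*_{ι|M}`. [cite: Liu2021, Thm 4.18 proof (FJcycle.tex l. 2250)]
[cite: SerreTate1968, §4 Thm. 5 (i)] -/
theorem finrank_cmEigenline_eq_one [NumberField M] (hℓ : (ℓ : E) ≠ 0) (hdim : Module.finrank ℚ M = 2 * B.dim) :
    Module.finrank (AlgebraicClosure ℚ_[ℓ]) (cmEigenline ℓ B M i ι) = 1 := by
  classical
  haveI := module_finite_tateModule_of_cast_ne_zero B ℓ hℓ
  haveI : Module.Finite ℚ_[ℓ] (B.rationalTateModule ℓ) :=
    inferInstanceAs (Module.Finite ℚ_[ℓ] (ℚ_[ℓ] ⊗[ℤ_[ℓ]] B.tateModule ℓ))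
  obtain ⟨b, hb⟩ :=
    Literature.AlgebraicGeometry.ComplexMultiplication.exists_basis_baseChange_rationalTateAction_eq_smul_ringHom
      hℓ i hdim (AlgebraicClosure ℚ_[ℓ])
  set ε := (TensorProduct.isBaseChange ℚ_[ℓ] (B.rationalTateModule ℓ) (AlgebraicClosure ℚ_[ℓ])).toDualBaseChange
    with hε
  set τ₀ : M →+* AlgebraicClosure ℚ_[ℓ] := ι.toRingHom.comp M.subtype with hτ₀
  set v := ε.symm (b.dualBasis τ₀) with hv
  have hv0 : v ≠ 0 := by
    rw [hv]
    exact fun h => b.dualBasis.ne_zero τ₀ (ε.symm.injective (h.trans (map_zero _).symm))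
  have heq : cmEigenline ℓ B M i ι = (AlgebraicClosure ℚ_[ℓ]) ∙ v := by
    ext x
    rw [mem_cmEigenline_iff_toDualBaseChange ℓ B M i ι hℓ, Submodule.mem_span_singleton]
    constructor
    · intro hx
      have hexp : ε x = ∑ τ, (ε x) (b τ) • b.dualBasis τ := by
        conv_lhs => rw [← b.dualBasis.sum_repr (ε x)]
        simp_rw [Module.Basis.dualBasis_repr]
      refine ⟨ε x (b τ₀), ε.injective ?_⟩
      rw [map_smul, hv, LinearEquiv.apply_symm_apply]
      conv_rhs => rw [hexp]
      rw [Finset.sum_eq_single τ₀ (fun τ _ hτ => by rw [apply_eigenbasis_eq_zero_of_ne hb hx hτ, zero_smul])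
        (fun h => absurd (Finset.mem_univ τ₀) h)]
    · rintro ⟨c, rfl⟩ a
      rw [map_smul, hv, LinearEquiv.apply_symm_apply, LinearMap.smul_comp, dualBasis_comp_baseChange_eq_smul hb,
        smul_comm]
  rw [heq]
  exact finrank_span_singleton hv0

/-- The eigenline is non-zero: it contains a non-zero vector `α`. [cite: Liu2021, Thm 4.18 proof (FJcycle.tex l. 2250)] -/
theorem exists_mem_cmEigenline_ne_zero [NumberField M] (hℓ : (ℓ : E) ≠ 0) (hdim : Module.finrank ℚ M = 2 * B.dim) :
    ∃ x ∈ cmEigenline ℓ B M i ι, x ≠ 0 := by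
  have h := finrank_cmEigenline_eq_one ℓ B M i ι hℓ hdim
  obtain ⟨v, hv⟩ := finrank_eq_one_iff'.mp h
  exact ⟨v.1, v.2, fun h0 => hv.1 (Subtype.ext h0)⟩


/-! ## §2 Operators commuting with `M` — in particular `Γ_E` — preserve the line and act on it by scalars -/

variable {ℓ B M i ι}

/-- An operator on `ℚ_ℓ^{ac} ⊗ H¹_ét(B)` commuting with the action of `M` maps the eigenline into itself.
[cite: Liu2021, Thm 4.18 proof (FJcycle.tex l. 2250–2263)] -/
theorem mem_cmEigenline_of_commute
    {T : Module.End (AlgebraicClosure ℚ_[ℓ]) (AlgebraicClosure ℚ_[ℓ] ⊗[ℚ_[ℓ]] Module.Dual ℚ_[ℓ] (B.rationalTateModule ℓ))}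
    (hT : ∀ m : M, T ∘ₗ ((rationalTateAction B ℓ (i m)).dualMap).baseChange _ = ((rationalTateAction B ℓ (i m)).dualMap).baseChange _ ∘ₗ T)
    {x : AlgebraicClosure ℚ_[ℓ] ⊗[ℚ_[ℓ]] Module.Dual ℚ_[ℓ] (B.rationalTateModule ℓ)} (hx : x ∈ cmEigenline ℓ B M i ι) :
    T x ∈ cmEigenline ℓ B M i ι := by
  intro m
  have h := LinearMap.congr_fun (hT m) x
  rw [LinearMap.comp_apply, LinearMap.comp_apply, hx m, map_smul] at h
  exact h.symm

variable (ℓ B M i ι) in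
/-- An operator commuting with the action of `M` acts on the eigenline `ℚ_ℓ^{ac}·α` by a SCALAR (the line is
one-dimensional and stable). [cite: Liu2021, Thm 4.18 proof (FJcycle.tex l. 2250–2263)] [cite: SerreTate1968, §4 Thm. 5 (i)] -/
theorem exists_apply_eq_smul_of_commute [NumberField M] (hℓ : (ℓ : E) ≠ 0) (hdim : Module.finrank ℚ M = 2 * B.dim)
    {T : Module.End (AlgebraicClosure ℚ_[ℓ]) (AlgebraicClosure ℚ_[ℓ] ⊗[ℚ_[ℓ]] Module.Dual ℚ_[ℓ] (B.rationalTateModule ℓ))}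
    (hT : ∀ m : M, T ∘ₗ ((rationalTateAction B ℓ (i m)).dualMap).baseChange _ = ((rationalTateAction B ℓ (i m)).dualMap).baseChange _ ∘ₗ T) :
    ∃ c : AlgebraicClosure ℚ_[ℓ], ∀ x ∈ cmEigenline ℓ B M i ι, T x = c • x := by
  obtain ⟨v, hv0, hv⟩ := finrank_eq_one_iff'.mp (finrank_cmEigenline_eq_one ℓ B M i ι hℓ hdim)
  obtain ⟨c, hc⟩ := hv ⟨T v.1, mem_cmEigenline_of_commute hT v.2⟩
  refine ⟨c, fun x hx => ?_⟩
  obtain ⟨d, hd⟩ := hv ⟨x, hx⟩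
  have hx' : x = d • (v : AlgebraicClosure ℚ_[ℓ] ⊗[ℚ_[ℓ]] Module.Dual ℚ_[ℓ] (B.rationalTateModule ℓ)) := congrArg Subtype.val hd.symm
  have hTv : T v.1 = c • (v : AlgebraicClosure ℚ_[ℓ] ⊗[ℚ_[ℓ]] Module.Dual ℚ_[ℓ] (B.rationalTateModule ℓ)) := congrArg Subtype.val hc.symm
  rw [hx', map_smul, hTv, smul_comm]

variable (ℓ B i) in
/-- The Galois action `σ ⊗ 1` on `ℚ_ℓ^{ac} ⊗ H¹_ét(B)` commutes with the action of `M` (endomorphisms are defined over `E`: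
`V_ℓ(i m) ∘ ρ(σ) = ρ(σ) ∘ V_ℓ(i m)`, tree `rationalTateAction_comm_rationalTateRep`, dualised and base-changed).
[cite: SerreTate1968, §4 (proof of Cor. 2 of Thm. 5)] -/
theorem galoisH1Bar_comp_dualMap_baseChange (σ : Field.absoluteGaloisGroup E) (m : M) :
    galoisH1Bar ℓ B σ ∘ₗ ((rationalTateAction B ℓ (i m)).dualMap).baseChange (AlgebraicClosure ℚ_[ℓ]) =
      ((rationalTateAction B ℓ (i m)).dualMap).baseChange (AlgebraicClosure ℚ_[ℓ]) ∘ₗ galoisH1Bar ℓ B σ := by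
  rw [galoisH1Bar, Representation.dual_apply, ← LinearMap.baseChange_comp, ← LinearMap.baseChange_comp]
  congr 1
  change ((B.rationalTateRep ℓ) σ⁻¹).dualMap ∘ₗ (rationalTateAction B ℓ (i m)).dualMap =
    (rationalTateAction B ℓ (i m)).dualMap ∘ₗ ((B.rationalTateRep ℓ) σ⁻¹).dualMap
  rw [LinearMap.dualMap_comp_dualMap, LinearMap.dualMap_comp_dualMap]
  have h := rationalTateAction_comm_rationalTateRep B ℓ (i m) σ⁻¹
  rw [Module.End.mul_eq_comp, Module.End.mul_eq_comp] at h
  rw [h]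

variable (ι) in
/-- **The eigenline `ℚ_ℓ^{ac}·α` is `Γ_E`-stable.** [cite: Liu2021, Thm 4.18 proof (FJcycle.tex l. 2263)] -/
theorem galoisH1Bar_mem_cmEigenline (σ : Field.absoluteGaloisGroup E)
    {x : AlgebraicClosure ℚ_[ℓ] ⊗[ℚ_[ℓ]] Module.Dual ℚ_[ℓ] (B.rationalTateModule ℓ)} (hx : x ∈ cmEigenline ℓ B M i ι) :
    galoisH1Bar ℓ B σ x ∈ cmEigenline ℓ B M i ι :=
  mem_cmEigenline_of_commute (galoisH1Bar_comp_dualMap_baseChange ℓ B i σ) hx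

variable (ℓ B M i ι) in
/-- **`Γ_E` acts on the line `ℚ_ℓ^{ac}·α` through a character**: every `σ ∈ Γ_E` acts on the eigenline by a scalar
`c = c(σ)` («the action of `Gal(ℂ/τ'(E))` on the line `ℚ_ℓ^{ac}·α` … is given by [a] character», l. 2263).
[cite: Liu2021, Thm 4.18 proof (FJcycle.tex l. 2263)] [cite: SerreTate1968, §4 Cor. 2 of Thm. 5] -/
theorem exists_galoisH1Bar_eq_smul [NumberField M] (hℓ : (ℓ : E) ≠ 0) (hdim : Module.finrank ℚ M = 2 * B.dim)
    (σ : Field.absoluteGaloisGroup E) : ∃ c : AlgebraicClosure ℚ_[ℓ], ∀ x ∈ cmEigenline ℓ B M i ι, galoisH1Bar ℓ B σ x = c • x :=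
  exists_apply_eq_smul_of_commute ℓ B M i ι hℓ hdim (galoisH1Bar_comp_dualMap_baseChange ℓ B i σ)

/-! ## §3 The `M`-polynomial projector onto the line (the `τ`-idempotent of `ℚ_ℓ^{ac} ⊗_ℚ M`) -/

variable (ℓ B M i ι) in
/-- **The eigenline is cut out by a polynomial in the `M`-action.**  There is a finite family `(c_j, m_j)` in
`ℚ_ℓ^{ac} × M` with `Σ c_j ι(m_j) = 1` such that the operator `P = Σ_j c_j (1 ⊗ ᵗV_ℓ(i m_j))` maps
`ℚ_ℓ^{ac} ⊗ H¹_ét(B)` INTO the eigenline and is the identity ON it (so `P` is a projector onto `ℚ_ℓ^{ac}·α` commuting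
with every operator that commutes with `M`, e.g. with `Γ_E` and with pull-backs `ᵗV_ℓ(f)`).  This is the image of the
`τ`-idempotent `e_τ ∈ ℚ_ℓ^{ac} ⊗_ℚ M ≅ ∏_{τ'} ℚ_ℓ^{ac}` (`τ = ι|_M`), obtained from the eigenbasis of `ℚ_ℓ^{ac} ⊗_ℚ M`
(Dedekind independence, tree `exists_basis_tensor_mul_eq_smul_ringHom`); no hypothesis on `B` is needed.
[cite: Shimura1998, §5.1 Lemma 1] [cite: Liu2021, Thm 4.18 proof (FJcycle.tex l. 2250–2263)] -/
theorem exists_cmEigenline_projector [NumberField M] :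
    ∃ S : Finset (AlgebraicClosure ℚ_[ℓ] × M),
      (∑ p ∈ S, p.1 * ι (p.2 : ℂ) = 1) ∧
      (∀ x, (∑ p ∈ S, p.1 • ((rationalTateAction B ℓ (i p.2)).dualMap).baseChange (AlgebraicClosure ℚ_[ℓ]) x) ∈
        cmEigenline ℓ B M i ι) ∧
      (∀ x ∈ cmEigenline ℓ B M i ι,
        (∑ p ∈ S, p.1 • ((rationalTateAction B ℓ (i p.2)).dualMap).baseChange (AlgebraicClosure ℚ_[ℓ]) x) = x) ∧
      (∀ (T : Module.End (AlgebraicClosure ℚ_[ℓ]) (AlgebraicClosure ℚ_[ℓ] ⊗[ℚ_[ℓ]] Module.Dual ℚ_[ℓ] (B.rationalTateModule ℓ))),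
        (∀ m : M, T ∘ₗ ((rationalTateAction B ℓ (i m)).dualMap).baseChange (AlgebraicClosure ℚ_[ℓ]) =
          ((rationalTateAction B ℓ (i m)).dualMap).baseChange (AlgebraicClosure ℚ_[ℓ]) ∘ₗ T) →
        ∀ x, (∑ p ∈ S, p.1 • ((rationalTateAction B ℓ (i p.2)).dualMap).baseChange (AlgebraicClosure ℚ_[ℓ]) (T x)) =
          T (∑ p ∈ S, p.1 • ((rationalTateAction B ℓ (i p.2)).dualMap).baseChange (AlgebraicClosure ℚ_[ℓ]) x)) := by
  classical
  -- the eigenbasis of `K ⊗_ℚ M` and the augmentation `λ = id ⊗ τ₀`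
  obtain ⟨β, hβ⟩ := Literature.AlgebraicGeometry.ComplexMultiplication.exists_basis_tensor_mul_eq_smul_ringHom
    (F := M) (AlgebraicClosure ℚ_[ℓ])
  set τ₀ : M →+* AlgebraicClosure ℚ_[ℓ] := ι.toRingHom.comp M.subtype with hτ₀
  let lam : AlgebraicClosure ℚ_[ℓ] ⊗[ℚ] M →ₐ[AlgebraicClosure ℚ_[ℓ]] AlgebraicClosure ℚ_[ℓ] :=
    Algebra.TensorProduct.lift (AlgHom.id (AlgebraicClosure ℚ_[ℓ]) (AlgebraicClosure ℚ_[ℓ])) τ₀.toRatAlgHom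
      (fun _ _ => Commute.all _ _)
  have lam_tmul : ∀ (c : AlgebraicClosure ℚ_[ℓ]) (m : M), lam (c ⊗ₜ m) = c * τ₀ m := fun c m => by
    rw [Algebra.TensorProduct.lift_tmul]; rfl
  have hlamβ : ∀ τ : M →+* AlgebraicClosure ℚ_[ℓ], τ ≠ τ₀ → lam (β τ) = 0 := by
    intro τ hτ
    obtain ⟨a, ha⟩ : ∃ a : M, τ a ≠ τ₀ a := by
      by_contra h
      exact hτ (RingHom.ext fun a => not_not.mp (not_exists.mp h a))
    have h := congrArg lam (hβ a τ)
    rw [map_mul, lam_tmul, one_mul, map_smul, smul_eq_mul] at h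
    have : (τ a - τ₀ a) * lam (β τ) = 0 := by rw [sub_mul, ← h, sub_self]
    exact (mul_eq_zero.mp this).resolve_left (sub_ne_zero.mpr ha)
  -- the `τ₀`-idempotent `e`
  set d := β.repr 1 with hd
  have h1 : (1 : AlgebraicClosure ℚ_[ℓ] ⊗[ℚ] M) = ∑ τ, d τ • β τ := (β.sum_repr 1).symm
  have hlam1 : d τ₀ * lam (β τ₀) = 1 := by
    have h := congrArg lam h1
    rw [map_one, map_sum] at h
    simp_rw [map_smul, smul_eq_mul] at h
    rw [Finset.sum_eq_single τ₀ (fun τ _ hτ => by rw [hlamβ τ hτ, mul_zero])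
      (fun h' => absurd (Finset.mem_univ τ₀) h')] at h
    exact h.symm
  set e := d τ₀ • β τ₀ with he
  have he_mul : ∀ a : M, ((1 : AlgebraicClosure ℚ_[ℓ]) ⊗ₜ[ℚ] a) * e = τ₀ a • e := fun a => by
    rw [he, mul_smul_comm, hβ, smul_comm]
  have he_lam : lam e = 1 := by rw [he, map_smul, smul_eq_mul, hlam1]
  -- the action of `M` on `K ⊗ H¹_ét(B)` as a ring homomorphism (transposition reverses products; `M` is commutative)
  let ΘR : M →+* Module.End (AlgebraicClosure ℚ_[ℓ])
      (AlgebraicClosure ℚ_[ℓ] ⊗[ℚ_[ℓ]] Module.Dual ℚ_[ℓ] (B.rationalTateModule ℓ)) :=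
    { toFun := fun m => ((rationalTateAction B ℓ (i m)).dualMap).baseChange (AlgebraicClosure ℚ_[ℓ])
      map_one' := by
        rw [map_one, map_one, Module.End.one_eq_id, LinearMap.dualMap_id, LinearMap.baseChange_id]
        rfl
      map_mul' := fun m m' => by
        rw [mul_comm m m', map_mul, map_mul, Module.End.mul_eq_comp, ← LinearMap.dualMap_comp_dualMap,
          LinearMap.baseChange_comp, Module.End.mul_eq_comp]
      map_zero' := by
        rw [map_zero, map_zero]
        change (Module.Dual.transpose (R := ℚ_[ℓ]) (0 : B.rationalTateModule ℓ →ₗ[ℚ_[ℓ]] B.rationalTateModule ℓ)).baseChange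
          (AlgebraicClosure ℚ_[ℓ]) = 0
        rw [map_zero, LinearMap.baseChange_zero]
      map_add' := fun m m' => by
        rw [map_add, map_add]
        change (Module.Dual.transpose (R := ℚ_[ℓ]) (rationalTateAction B ℓ (i m) + rationalTateAction B ℓ (i m'))).baseChange
          (AlgebraicClosure ℚ_[ℓ]) = _
        rw [map_add, LinearMap.baseChange_add]
        rfl }
  have ΘR_apply : ∀ m : M, ΘR m = ((rationalTateAction B ℓ (i m)).dualMap).baseChange (AlgebraicClosure ℚ_[ℓ]) :=
    fun m => rfl
  let Θt : AlgebraicClosure ℚ_[ℓ] ⊗[ℚ] M →ₐ[AlgebraicClosure ℚ_[ℓ]] Module.End (AlgebraicClosure ℚ_[ℓ])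
      (AlgebraicClosure ℚ_[ℓ] ⊗[ℚ_[ℓ]] Module.Dual ℚ_[ℓ] (B.rationalTateModule ℓ)) :=
    Algebra.TensorProduct.lift (Algebra.ofId _ _) ΘR.toRatAlgHom (fun c y => Algebra.commute_algebraMap_left c _)
  have Θt_tmul : ∀ (c : AlgebraicClosure ℚ_[ℓ]) (m : M), Θt (c ⊗ₜ m) = c • ΘR m := fun c m => by
    rw [Algebra.TensorProduct.lift_tmul, Algebra.ofId_apply, ← Algebra.smul_def]; rfl
  have hcomm : ∀ a : M, ΘR a * Θt e = τ₀ a • Θt e := fun a => by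
    have h : Θt ((1 : AlgebraicClosure ℚ_[ℓ]) ⊗ₜ a) = ΘR a := by rw [Θt_tmul, one_smul]
    rw [← h, ← map_mul, he_mul, map_smul]
  have hline : ∀ x ∈ cmEigenline ℓ B M i ι, ∀ r, Θt r x = lam r • x := by
    intro x hx r
    induction r using TensorProduct.induction_on with
    | zero => rw [map_zero, map_zero, LinearMap.zero_apply, zero_smul]
    | tmul c m => rw [Θt_tmul, lam_tmul, LinearMap.smul_apply, ΘR_apply, hx m, smul_smul]; rfl
    | add x' y' hx' hy' => rw [map_add, map_add, LinearMap.add_apply, hx', hy', add_smul]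
  -- expand `e` as a finite sum of pure tensors
  obtain ⟨S, hS⟩ := TensorProduct.exists_finset e
  have hsum : ∀ x, (∑ p ∈ S, p.1 • ((rationalTateAction B ℓ (i p.2)).dualMap).baseChange (AlgebraicClosure ℚ_[ℓ]) x) =
      Θt e x := fun x => by
    rw [hS, map_sum, LinearMap.sum_apply]
    refine Finset.sum_congr rfl fun p _ => ?_
    rw [Θt_tmul, LinearMap.smul_apply, ΘR_apply]
  refine ⟨S, ?_, fun x => ?_, fun x hx => ?_, fun T hT x => ?_⟩
  · have h := he_lam
    rw [hS, map_sum] at h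
    simp_rw [lam_tmul] at h
    exact h
  · rw [hsum x]
    intro a
    have h := LinearMap.congr_fun (hcomm a) x
    rw [Module.End.mul_apply, LinearMap.smul_apply, ΘR_apply] at h
    exact h
  · rw [hsum x, hline x hx e, he_lam, one_smul]
  · rw [map_sum]
    refine Finset.sum_congr rfl fun p _ => ?_
    rw [map_smul, ← LinearMap.comp_apply, ← hT p.2, LinearMap.comp_apply]

end CMLine

end Literature.NumberTheory.Automorphic.Liu2021.AppendixC

end
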